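import Summits.BirchSwinnertonDyer.Rank1Residual.X1.MuLambdaAlgebra
import Literature.NumberTheory.EllipticCurves.IwasawaSelmer
import Literature.NumberTheory.EllipticCurves.IwasawaAlgebraDivisibilityProofs
import Literature.NumberTheory.EllipticCurves.IwasawaModuleFinitePadicIntProofs
import Literature.NumberTheory.EllipticCurves.KatoFineSelmerDualMuProofs
import Literature.NumberTheory.EllipticCurves.FineSelmerClassGroupCriterion
import HarnessLib

/-!
# Route `AlignedTransportAtTwo`, crux C2 `MainConjectureOfRankZeroBSDAtTwo` (stmt-BirchSwinnertonDyer-22298):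
# the `μ`-PART ROAD AT `𝔭 = (2)` THROUGH COATES–SUJATHA'S STATEMENT (A) — road (b) for stub T of line `birth`

HONEST FRAMING (cell `bsd-f1-sign2`, HOME `run/shared/lean/pub/bsd-f1-sign2/`, lead prover seat
`bsd-line-att-p2` gen 2; BSD is NOT proved by any of this). THEOREMS ONLY — no definition, no named fact,
nothing asserted. The lead's gen-0 file (`…MainConjectureOfRankZeroBSDAtTwoSeed`, p583329) proved that MODULO
PRINT the crux C2 is EQUIVALENT to its stub T = «`μ₂(X(W/ℚ_∞)) = 0` for every seed-cell curve» (Greenberg,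
LNM 1716, Conj. 1.11 at `p = 2`; open — Greenberg p. 137: «very difficult to verify even for specific
examples»), and that on the CERTIFICATE road (per-seed tower gaps) C2's own analytic hypothesis `μ(L₂) = 0` is
IDLE. This file opens the second road to T, on which that hypothesis is LOAD-BEARING, and isolates what is
left at `p = 2`:

* §1–§2 (pure commutative algebra, any domain / `Λ = ℤ_p⟦T⟧`): Kato's §17.13 bookkeeping at ONE height-one
  prime WITHOUT the Euler-system bound (Thm. 12.5 (4) — the clause that prints `p ≠ 2`), in FINE form: from
  the Poitou–Tate row `𝐇¹ → P → X → X₀` (cokernel of `P → X` = dual fine Selmer group, (14.9.3)), a Coleman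
  map `col : P → Λ` and ONE zeta class with `col (loc z) = pⁿ·s·G`:
  `μ(X) ≤ μ(ker col) + n + μ(G) + μ(X₀)` (`lengthAt_augIdealP_le_of_fineSkeleton`); hence `μ(X) = 0` from
  `col` injective, `n = 0`, `μ(G) = 0` and `μ(X₀) = 0`, and `μ(X) ≤ n` in general
  (`muInvariant_le_defect_of_fineSkeleton`: on this road the whole `μ`-part at `2` is ONE local exponent).
* §3 (the tree's objects at `2`): `X = X(E/ℚ_∞)` (`SelmerDualData`, strict at `∞`), `X₀ = X₀(E/ℚ_∞)`
  (`FineSelmerDualData`); statement (A) at `(E, 2)` in the intrinsic form «`Sel₀(ℚ_∞, E[2^∞])[2]` finite»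
  kills `ℓ_{(2)}(X₀)` (Pontryagin algebra of the tree); `selmerDual_mu_eq_zero_of_fineSkeleton_two` /
  `…_mu_le_defect_…`: the per-datum statements with the Kato data DISPLAYED as hypotheses.
* §4: statement (A) at `(E, 2)` ⟸ Lim 2017 Thm. 3.5 at `2` (tree fact, PRINT) + Iwasawa's CLASSICAL `μ = 0`
  for ONE subfield `L ⊆ ℚ(E[4])` of `2`-power index — on the cell the cubic field `ℚ(e₁)`
  (`[ℚ(E[4]):ℚ] ∣ 96 = 2⁵·3`); and, by Ferrero–Washington (tree fact), UNCONDITIONALLY-mod-print when that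
  subfield is ABELIAN (cyclic cubic `2`-division field = image `C₃`; `L = ℚ` = rational `2`-torsion).
* §5 (sibling file `…FineRoadCrux`): the crux. `mazurMainConjecture_two_of_bsdp_of_fineRoad` (per curve: a THIRD certificate door beside
  `TowerGapAtTwo` (p583329/att-p4) and the `λ`-match (att-p5)); `seedMuZeroAtTwo_of_fineRoad` (stub T) and
  `mainConjectureOfRankZeroBSDAtTwo_of_fineRoad` (C2 BY NAME) from PRINT + (K₂) + (A₂):
  (K₂) = Kato's §17.13 data at GOOD ORDINARY `2` in fine form with injective Coleman map and NO `2`-power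
  defect in the zeta image of the integral lift of `L₂(f, α)` — a construction TARGET, NOT in print (Kato
  prints 17.11 / 16.6 / (17.13.1) and even Conj. 12.10 at `p = 2` only at `𝔭 ∌ 2`; the `Δ = {±1}`-descent
  from `ℚ(ζ_{2^∞})`, the archimedean strict/relaxed `2`-torsion and the anomalous factor at `2` are where
  `2ⁿ` may appear: cell bsd-2adic audit D-AUDIT-h17 rows C1–C3); (A₂) = classical `μ = 0` for the seeds'
  `S₃` cubic fields — Iwasawa's conjecture, OPEN (Ferrero–Washington covers abelian fields only), with
  per-field numeric doors (Iwasawa 1956 / Fukuda 1994, `IwasawaTheory/ClassicalMuInvariant.lean`).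

WHAT THIS DOES NOT DO: close C2 (both (K₂) and (A₂) are displayed, not proved); construct any Kato object
at `2`; assert anything about `𝐇²`. Road (a) (Greenberg Conj. 1.11 at `2`) and road (b) (this file) meet
in T; (b) splits T into a LOCAL statement at `2` and a CLASS-GROUP statement about cubic fields.

References: K. Kato, Astérisque 295 (2004), §12.1, Thm. 12.5, Conj. 12.10, (14.9.3), Thm. 16.6, Prop. 17.11,
§17.13; J. Coates, R. Sujatha, Math. Ann. 331 (2005) §3; M. F. Lim, Asian J. Math. 21 (2017) §3 Thm. 3.5;
R. Greenberg, LNM 1716 (1999), §1 Conj. 1.11, Thm. 4.1, §5 p. 137; B. Ferrero, L. Washington, Ann. of Math.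
109 (1979) (via Lang, *Cyclotomic Fields I–II*, Ch. 10 §3 Thm. 3.4); L. Washington, GTM 83, §13.2.
-/

set_option linter.dupNamespace false
set_option autoImplicit false

noncomputable section

open scoped Classical

open Literature.NumberTheory.EllipticCurves Literature.NumberTheory.EllipticCurves.Module

namespace Summit.BirchSwinnertonDyer.BirchSwinnertonDyer.Theorems.AlignedTransportAtTwoFineRoad

/-! ## §1 The bookkeeping at one height-one prime, over any domain, WITHOUT an Euler-system bound -/

section Skeleton

variable {R : Type*} [CommRing R] [IsDomain R]
  {H P X Y : Type*} [AddCommGroup H] [_root_.Module R H] [AddCommGroup P] [_root_.Module R P]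
  [AddCommGroup X] [_root_.Module R X] [AddCommGroup Y] [_root_.Module R Y]

/-- **Kato's §17.13 bookkeeping at ONE height-one prime WITHOUT the Euler-system bound, fine form.**
Data: `loc : H → P`, `toX : P → X`, `π : X → Y` with `toX ∘ loc = 0` and `P → X → Y` exact at `X`
(the Poitou–Tate row `𝐇¹ → 𝐇¹_loc/𝐇¹_f → X → X₀`, (14.9.3)/(17.13.1) with the cokernel of `P → X` read
as the dual FINE Selmer group), a "Coleman map" `col : P → R` (NOT assumed injective) and ONE class
`z ∈ H` with `col (loc z) = d · G` (`d` = the local defect, `G` = the `p`-adic `L`-function). Then at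
every prime `𝔭`:
`ℓ_𝔭(X) ≤ ℓ_𝔭(ker col) + ℓ_𝔭(R/(d)) + ℓ_𝔭(R/(G)) + ℓ_𝔭(Y)`.
Proof: `R·loc z ⊆ ker toX`, so `X` is an extension of a submodule of `Y` by a quotient of
`P/R·loc z`; and `P/R·loc z → R/(dG)` has kernel the image of `ker col`. No Euler system, no `𝐇²`.
[cite: Kato2004Asterisque, §17.13 (pp. 279–280) and (14.9.3) (p. 240)] -/
theorem lengthAt_le_of_fineSkeleton (loc : H →ₗ[R] P) (toX : P →ₗ[R] X) (π : X →ₗ[R] Y)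
    (col : P →ₗ[R] R) (h0 : ∀ h, toX (loc h) = 0) (hX : Function.Exact toX π)
    {z : H} {d G : R} (hd : d ≠ 0) (hz : col (loc z) = d * G) (𝔭 : PrimeSpectrum R) :
    lengthAt R X 𝔭 ≤ lengthAt R (LinearMap.ker col) 𝔭 + lengthAt R (R ⧸ Ideal.span {d}) 𝔭 +
      lengthAt R (R ⧸ Ideal.span {G}) 𝔭 + lengthAt R Y 𝔭 := by
  -- the line `LZ = R · loc z` and its image `M = (d G)` under `col`
  set LZ : Submodule R P := R ∙ loc z with hLZ
  set M : Ideal R := Ideal.span {d * G} with hM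
  have hMeq : Submodule.map col LZ = M := by
    rw [hLZ, hM, Submodule.map_span, Set.image_singleton, hz]
  have hLZM : ∀ y ∈ LZ, col y ∈ M := fun y hy => hMeq ▸ Submodule.mem_map_of_mem hy
  -- (a) `P/LZ → R/M` has kernel the image of `ker col`
  let q : (P ⧸ LZ) →ₗ[R] (R ⧸ M) := Submodule.mapQ LZ M col hLZM
  let j : LinearMap.ker col →ₗ[R] (P ⧸ LZ) := LZ.mkQ ∘ₗ (LinearMap.ker col).subtype
  have hjq : Function.Exact j q := by
    rw [LinearMap.exact_iff]
    change LinearMap.ker (Submodule.mapQ LZ M col hLZM) = LinearMap.range (LZ.mkQ ∘ₗ _)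
    rw [Submodule.ker_mapQ, ← hMeq, Submodule.comap_map_eq, Submodule.map_sup,
      Submodule.mkQ_map_self, bot_sup_eq, LinearMap.range_comp, Submodule.range_subtype]
  have h1 : lengthAt R (P ⧸ LZ) 𝔭 ≤ lengthAt R (LinearMap.ker col) 𝔭 + lengthAt R (R ⧸ M) 𝔭 :=
    lengthAt_le_add_of_exact j q hjq 𝔭
  -- (b) `P/LZ → X → Y` exact at `X`
  have hle : LZ ≤ LinearMap.ker toX := by
    rw [hLZ, Submodule.span_singleton_le_iff_mem, LinearMap.mem_ker]
    exact h0 z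
  let f' : (P ⧸ LZ) →ₗ[R] X := LZ.liftQ toX hle
  have hf' : Function.Exact f' π := by
    rw [LinearMap.exact_iff, Submodule.range_liftQ]
    exact LinearMap.exact_iff.mp hX
  have h2 : lengthAt R X 𝔭 ≤ lengthAt R (P ⧸ LZ) 𝔭 + lengthAt R Y 𝔭 :=
    lengthAt_le_add_of_exact f' π hf' 𝔭
  -- (c) `ℓ(R/(dG)) = ℓ(R/(d)) + ℓ(R/(G))`
  have h3 : lengthAt R (R ⧸ M) 𝔭 =
      lengthAt R (R ⧸ Ideal.span {d}) 𝔭 + lengthAt R (R ⧸ Ideal.span {G}) 𝔭 :=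
    lengthAt_quotient_span_singleton_mul G hd 𝔭
  calc lengthAt R X 𝔭 ≤ lengthAt R (P ⧸ LZ) 𝔭 + lengthAt R Y 𝔭 := h2
    _ ≤ (lengthAt R (LinearMap.ker col) 𝔭 + lengthAt R (R ⧸ M) 𝔭) + lengthAt R Y 𝔭 := by
        gcongr
    _ = _ := by rw [h3]; simp only [add_assoc]

end Skeleton

/-! ## §2 Over `Λ = ℤ_p⟦T⟧` at the prime `(p)`: the `μ`-inequality `μ(X) ≤ μ(ker col) + n + μ(G) + μ(Y)` -/

section AtP

variable (p : ℕ) [Fact p.Prime]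
  {H P X Y : Type*} [AddCommGroup H] [_root_.Module (IwasawaAlgebra p) H]
  [AddCommGroup P] [_root_.Module (IwasawaAlgebra p) P]
  [AddCommGroup X] [_root_.Module (IwasawaAlgebra p) X]
  [AddCommGroup Y] [_root_.Module (IwasawaAlgebra p) Y]

/-- **The `μ`-bookkeeping at `𝔭 = (p)`.** In the situation of `lengthAt_le_of_fineSkeleton` over
`Λ = ℤ_p⟦T⟧`, with the zeta class hitting `pⁿ · s · G`, `s ∉ (p)` (`pⁿ` = the LOCAL DEFECT of the Coleman
map / zeta image at `(p)`; at an odd good ordinary prime with big image `n = 0` by Kato 17.11 + 16.6 +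
12.5 (4), at `p = 2` it is NOT pinned by print):
`ℓ_{(p)}(X) ≤ ℓ_{(p)}(ker col) + n + ℓ_{(p)}(Λ/(G)) + ℓ_{(p)}(Y)`, i.e. `μ(X) ≤ μ(ker col) + n + μ(G) + μ(Y)`.
[cite: Kato2004Asterisque, §17.13 (p. 280)] [cite: Washington1997, §13.2] -/
theorem lengthAt_augIdealP_le_of_fineSkeleton (loc : H →ₗ[IwasawaAlgebra p] P)
    (toX : P →ₗ[IwasawaAlgebra p] X) (π : X →ₗ[IwasawaAlgebra p] Y)
    (col : P →ₗ[IwasawaAlgebra p] IwasawaAlgebra p) (h0 : ∀ h, toX (loc h) = 0)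
    (hX : Function.Exact toX π) {z : H} {n : ℕ} {s G : IwasawaAlgebra p}
    (hs : s ∉ IwasawaAlgebra.augIdealP p)
    (hz : col (loc z) = PowerSeries.C (p : ℤ_[p]) ^ n * s * G)
    (𝔭 : PrimeSpectrum (IwasawaAlgebra p)) (h𝔭 : 𝔭.asIdeal = IwasawaAlgebra.augIdealP p) :
    lengthAt (IwasawaAlgebra p) X 𝔭 ≤ lengthAt (IwasawaAlgebra p) (LinearMap.ker col) 𝔭 + n +
      lengthAt (IwasawaAlgebra p) (IwasawaAlgebra p ⧸ Ideal.span {G}) 𝔭 +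
      lengthAt (IwasawaAlgebra p) Y 𝔭 := by
  have hπ := IwasawaAlgebra.prime_C p
  have hs' : ¬ PowerSeries.C (p : ℤ_[p]) ∣ s := by
    rwa [IwasawaAlgebra.augIdealP, Ideal.mem_span_singleton] at hs
  have hd : PowerSeries.C (p : ℤ_[p]) ^ n * s ≠ 0 :=
    mul_ne_zero (pow_ne_zero _ hπ.ne_zero) fun h => hs' (h ▸ dvd_zero _)
  have h := lengthAt_le_of_fineSkeleton loc toX π col h0 hX hd hz 𝔭
  rwa [lengthAt_quotient_span_singleton_pow_mul hπ n hs' 𝔭 (by rw [h𝔭]; rfl)] at h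

/-- **`μ(X) = 0` from the fine road**: if moreover the Coleman map is injective (Kato Prop. 17.11's
shape), the local defect is `n = 0`, `G ∉ (p)` (`μ(G) = 0`: the ANALYTIC `μ` vanishes) and
`ℓ_{(p)}(Y) = 0` (`μ(X₀) = 0`: Coates–Sujatha's statement (A)), then `ℓ_{(p)}(X) = 0`.
[cite: Kato2004Asterisque, §17.13 (p. 280)] [cite: CoatesSujatha2005, statement (A) (§3)] -/
theorem lengthAt_augIdealP_eq_zero_of_fineSkeleton (loc : H →ₗ[IwasawaAlgebra p] P)
    (toX : P →ₗ[IwasawaAlgebra p] X) (π : X →ₗ[IwasawaAlgebra p] Y)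
    (col : P →ₗ[IwasawaAlgebra p] IwasawaAlgebra p) (hcol : Function.Injective col)
    (h0 : ∀ h, toX (loc h) = 0) (hX : Function.Exact toX π) {z : H} {s G : IwasawaAlgebra p}
    (hs : s ∉ IwasawaAlgebra.augIdealP p) (hG : G ∉ IwasawaAlgebra.augIdealP p)
    (hz : col (loc z) = s * G)
    (𝔭 : PrimeSpectrum (IwasawaAlgebra p)) (h𝔭 : 𝔭.asIdeal = IwasawaAlgebra.augIdealP p)
    (hY : lengthAt (IwasawaAlgebra p) Y 𝔭 = 0) : lengthAt (IwasawaAlgebra p) X 𝔭 = 0 := by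
  have hk : LinearMap.ker col = ⊥ := LinearMap.ker_eq_bot.mpr hcol
  have hker : lengthAt (IwasawaAlgebra p) (LinearMap.ker col) 𝔭 = 0 := by
    rw [hk]; exact lengthAt_eq_zero_of_subsingleton 𝔭
  have hGq : lengthAt (IwasawaAlgebra p) (IwasawaAlgebra p ⧸ Ideal.span {G}) 𝔭 = 0 :=
    lengthAt_quotient_eq_zero_of_not_le (by rwa [Ideal.span_singleton_le_iff_mem, h𝔭])
  have h := lengthAt_augIdealP_le_of_fineSkeleton p loc toX π col h0 hX (n := 0) hs
    (by rw [hz, pow_zero, one_mul]) 𝔭 h𝔭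
  rw [hker, hGq, hY, Nat.cast_zero] at h
  simpa using h

/-- **`μ(X) ≤ n`**: with an injective Coleman map, `μ(G) = 0` and `μ(Y) = 0`, the `μ`-invariant of `X`
is at most the local defect exponent `n` — the only place a power of `p` can hide on this road.
[cite: Kato2004Asterisque, §17.13 (p. 280)] [cite: Washington1997, §13.2] -/
theorem muInvariant_le_defect_of_fineSkeleton (loc : H →ₗ[IwasawaAlgebra p] P)
    (toX : P →ₗ[IwasawaAlgebra p] X) (π : X →ₗ[IwasawaAlgebra p] Y)
    (col : P →ₗ[IwasawaAlgebra p] IwasawaAlgebra p) (hcol : Function.Injective col)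
    (h0 : ∀ h, toX (loc h) = 0) (hX : Function.Exact toX π) {z : H} {n : ℕ}
    {s G : IwasawaAlgebra p} (hs : s ∉ IwasawaAlgebra.augIdealP p)
    (hG : G ∉ IwasawaAlgebra.augIdealP p)
    (hz : col (loc z) = PowerSeries.C (p : ℤ_[p]) ^ n * s * G)
    (hY : lengthAt (IwasawaAlgebra p) Y
      ⟨IwasawaAlgebra.augIdealP p, IwasawaAlgebra.isPrime_augIdealP_holds p⟩ = 0) :
    muInvariant p X ≤ n := by
  let 𝔭 : PrimeSpectrum (IwasawaAlgebra p) :=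
    ⟨IwasawaAlgebra.augIdealP p, IwasawaAlgebra.isPrime_augIdealP_holds p⟩
  have hk : LinearMap.ker col = ⊥ := LinearMap.ker_eq_bot.mpr hcol
  have hker : lengthAt (IwasawaAlgebra p) (LinearMap.ker col) 𝔭 = 0 := by
    rw [hk]; exact lengthAt_eq_zero_of_subsingleton 𝔭
  have hGq : lengthAt (IwasawaAlgebra p) (IwasawaAlgebra p ⧸ Ideal.span {G}) 𝔭 = 0 :=
    lengthAt_quotient_eq_zero_of_not_le (by rwa [Ideal.span_singleton_le_iff_mem])
  have h := lengthAt_augIdealP_le_of_fineSkeleton p loc toX π col h0 hX hs hz 𝔭 rfl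
  rw [hker, hGq, hY, zero_add, add_zero, add_zero] at h
  rw [muInvariant_eq_toNat_lengthAt p X 𝔭 rfl]
  exact ENat.toNat_le_of_le_coe h

end AtP

/-! ## §3 The tree's objects at `p = 2`: `X(E/ℚ_∞)` (`SelmerDualData`), `X₀(E/ℚ_∞)` (`FineSelmerDualData`) -/

section AtTwo

open WeierstrassCurve Literature.NumberTheory.EllipticCurves.IwasawaModuleFinitePadicInt
  Summit.BirchSwinnertonDyer.Rank1Residual.X1.MuLambda

variable (W : WeierstrassCurve ℚ) {κ : ZpExtension ℚ 2} {γ : Field.absoluteGaloisGroup ℚ}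

/-- **Coates–Sujatha's statement (A) at `(E, 2)` kills the `(2)`-length of the dual fine Selmer group**:
if `Sel₀(ℚ_∞, E[2^∞])[2]` is finite, then for every Pontryagin-dual datum `Yd` of `Sel₀(ℚ_∞, E[2^∞])`
(with respect to a topological generator `γ`) `ℓ_{(2)}(X₀) = 0`: `X₀` is finitely generated over `Λ`
with `X₀/2X₀` finite (Pontryagin duality, tree), hence torsion with `μ(X₀) = 0`.
[cite: CoatesSujatha2005, statement (A) (§3)] [cite: GreenbergLNM1716, §1 p. 60 (after Conj. 1.3)] -/
theorem lengthAt_fineSelmerDual_eq_zero_of_finite_twoTorsion (hγ : κ.IsTopGenerator γ)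
    (Yd : W.FineSelmerDualData κ γ) (hA : Set.Finite {s : W.fineSelmerInfty κ | 2 • s = 0}) :
    lengthAt (IwasawaAlgebra 2) Yd.X
      ⟨IwasawaAlgebra.augIdealP 2, IwasawaAlgebra.isPrime_augIdealP_holds 2⟩ = 0 := by
  haveI : Module.Finite (IwasawaAlgebra 2) Yd.X := Yd.module_finite_of_finite_pTorsion hγ hA
  have hq := Yd.finite_quotient_augIdealP_of_finite_pTorsion hA
  have hT : Module.IsTorsion (IwasawaAlgebra 2) Yd.X :=
    isTorsion_of_finite_quotient_augIdealP 2 Yd.X hq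
  have hμ : muInvariant 2 Yd.X = 0 := muInvariant_eq_zero_of_finite_quotient_augIdealP 2 Yd.X hT hq
  have hne := lengthAt_ne_top_of_isTorsion 2 Yd.X hT
    ⟨IwasawaAlgebra.augIdealP 2, IwasawaAlgebra.isPrime_augIdealP_holds 2⟩ rfl
  rw [muInvariant_eq_toNat_lengthAt 2 Yd.X
    ⟨IwasawaAlgebra.augIdealP 2, IwasawaAlgebra.isPrime_augIdealP_holds 2⟩ rfl] at hμ
  rcases ENat.toNat_eq_zero.mp hμ with h | h
  · exact h
  · exact absurd h hne

/-- `red G ≠ 0` (the crux's analytic `μ = 0` currency: `2 ∤ G` in `Λ`) iff-free reading: `G ∉ (2)`. [folklore] -/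
theorem not_mem_augIdealP_of_red_ne_zero {p : ℕ} [Fact p.Prime] {G : IwasawaAlgebra p}
    (hG : red G ≠ 0) : G ∉ IwasawaAlgebra.augIdealP p := by
  intro h
  rw [IwasawaAlgebra.augIdealP, Ideal.mem_span_singleton] at h
  exact hG ((red_eq_zero_iff G).mpr h)

/-- **THE FINE ROAD AT `2`, per curve and per cyclotomic datum.** Let `X = X(E/ℚ_∞)` (`D`) and
`X₀ = X₀(E/ℚ_∞)` (`Yd`) be the Pontryagin duals of `Sel_{2^∞}(E/ℚ_∞)` and of its fine part, `γ` a
topological generator. GIVEN Kato-shaped data at `2` — abstract `Λ`-modules `H` (`= 𝐇¹_Iw(ℤ[1/2N], T₂E)`),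
`P` (`= 𝐇¹_Iw(ℚ₂, T₂E)/𝐇¹_f`), maps `loc : H → P`, `toX : P → X`, `π : X → X₀` with `toX ∘ loc = 0` and
`P → X → X₀` exact at `X` (the Poitou–Tate row (14.9.3)/(17.13.1) in fine form), an INJECTIVE Coleman map
`col : P → Λ` (Prop. 17.11's shape) and ONE class `z ∈ H` with `col (loc z) = s · G`, `s ∉ (2)` (Thm. 16.6's
shape with NO `2`-power defect), where `G ∈ Λ` is `2`-indivisible (`red G ≠ 0` — for the integral lift of
`L₂(f, α)` this is the crux's analytic `μ₂ = 0`) — Coates–Sujatha's statement (A) at `(E, 2)`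
(`Sel₀(ℚ_∞, E[2^∞])[2]` finite) gives `μ(X(E/ℚ_∞)) = 0`. The data are DISPLAYED, not asserted: at a good
ordinary `2` they are a construction TARGET (Kato prints 17.11/16.6/(17.13.1) at `p = 2` only away from
`𝔭 ∋ 2`: Conj. 12.10 itself excludes `𝔭 ∋ 2` when `p = 2`). [cite: Kato2004Asterisque, §17.13 (pp. 279–280), Conj. 12.10 (p. 224)]
[cite: CoatesSujatha2005, statement (A) (§3)] -/
theorem selmerDual_mu_eq_zero_of_fineSkeleton_two (hγ : κ.IsTopGenerator γ)
    (D : W.SelmerDualData κ γ) (Yd : W.FineSelmerDualData κ γ)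
    (hA : Set.Finite {s : W.fineSelmerInfty κ | 2 • s = 0})
    {G : IwasawaAlgebra 2} (hred : red G ≠ 0)
    {H P : Type*} [AddCommGroup H] [_root_.Module (IwasawaAlgebra 2) H]
    [AddCommGroup P] [_root_.Module (IwasawaAlgebra 2) P]
    (loc : H →ₗ[IwasawaAlgebra 2] P) (toX : P →ₗ[IwasawaAlgebra 2] D.X)
    (π : D.X →ₗ[IwasawaAlgebra 2] Yd.X) (col : P →ₗ[IwasawaAlgebra 2] IwasawaAlgebra 2)
    (hcol : Function.Injective col) (h0 : ∀ h, toX (loc h) = 0) (hX : Function.Exact toX π)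
    {z : H} {s : IwasawaAlgebra 2} (hs : s ∉ IwasawaAlgebra.augIdealP 2)
    (hz : col (loc z) = s * G) : D.mu = 0 := by
  have hX0 := lengthAt_augIdealP_eq_zero_of_fineSkeleton 2 loc toX π col hcol h0 hX hs
    (not_mem_augIdealP_of_red_ne_zero hred) hz
    ⟨IwasawaAlgebra.augIdealP 2, IwasawaAlgebra.isPrime_augIdealP_holds 2⟩ rfl
    (lengthAt_fineSelmerDual_eq_zero_of_finite_twoTorsion W hγ Yd hA)
  change muInvariant 2 D.X = 0
  rw [muInvariant_eq_toNat_lengthAt 2 D.X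
    ⟨IwasawaAlgebra.augIdealP 2, IwasawaAlgebra.isPrime_augIdealP_holds 2⟩ rfl, hX0]
  rfl

/-- **The `±` bookkeeping at `2`, quantified**: the same data with a `2`-POWER DEFECT `2ⁿ` in the zeta
image (`col (loc z) = 2ⁿ · s · G` — where the `Δ = {±1}`-descent from `ℚ(ζ_{2^∞})` to `ℚ_∞`, the
archimedean strict/relaxed `2`-torsion and the anomalous factor at `2` may deposit powers of `2`) give
`μ(X(E/ℚ_∞)) ≤ n` under statement (A). So on this road the whole `μ`-part of Mazur's main conjecture at
`2` is the single local exponent `n`. [cite: Kato2004Asterisque, §12.1 (pp. 219–220) and §17.13 (p. 279: «exact upto ×2 in the case p = 2»)]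
[cite: CoatesSujatha2005, statement (A) (§3)] -/
theorem selmerDual_mu_le_defect_of_fineSkeleton_two (hγ : κ.IsTopGenerator γ)
    (D : W.SelmerDualData κ γ) (Yd : W.FineSelmerDualData κ γ)
    (hA : Set.Finite {s : W.fineSelmerInfty κ | 2 • s = 0})
    {G : IwasawaAlgebra 2} (hred : red G ≠ 0)
    {H P : Type*} [AddCommGroup H] [_root_.Module (IwasawaAlgebra 2) H]
    [AddCommGroup P] [_root_.Module (IwasawaAlgebra 2) P]
    (loc : H →ₗ[IwasawaAlgebra 2] P) (toX : P →ₗ[IwasawaAlgebra 2] D.X)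
    (π : D.X →ₗ[IwasawaAlgebra 2] Yd.X) (col : P →ₗ[IwasawaAlgebra 2] IwasawaAlgebra 2)
    (hcol : Function.Injective col) (h0 : ∀ h, toX (loc h) = 0) (hX : Function.Exact toX π)
    {z : H} {n : ℕ} {s : IwasawaAlgebra 2} (hs : s ∉ IwasawaAlgebra.augIdealP 2)
    (hz : col (loc z) = PowerSeries.C (2 : ℤ_[2]) ^ n * s * G) : D.mu ≤ n :=
  muInvariant_le_defect_of_fineSkeleton 2 loc toX π col hcol h0 hX hs
    (not_mem_augIdealP_of_red_ne_zero hred) (by exact_mod_cast hz)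
    (lengthAt_fineSelmerDual_eq_zero_of_finite_twoTorsion W hγ Yd hA)

end AtTwo

/-! ## §4 Statement (A) at `(E, 2)` from the CLASSICAL `μ = 0` of a subfield of `ℚ(E[4])` (Lim 2017 at `p = 2`) -/

section ConjA

open WeierstrassCurve Literature.NumberTheory.IwasawaTheory
  Literature.NumberTheory.EllipticCurves.IwasawaModuleFinitePadicInt

variable (W : WeierstrassCurve ℚ) [W.IsElliptic]

/-- **Statement (A) at `(E, 2)` from Iwasawa's classical `μ = 0` for ONE subfield `L ⊆ ℚ(E[4])` of
`2`-power index** (Lim 2017, Thm. 3.5 with Lemma 3.2 at `p = 2`, tree fact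
`Lim2017.thm35_at_two_fineSelmerDual_moduleFinite_of_classicalMuVanishes_of_le_divisionField_four`):
`Sel₀(ℚ_∞, E[2^∞])[2]` is finite. On the route's cell (no rational point of order `2`, so the `2`-division
cubic is irreducible) the intended `L` is the CUBIC FIELD `ℚ(e₁)` of a root of the `2`-division cubic:
`[ℚ(E[4]) : ℚ]` divides `#GL₂(ℤ/4) = 96 = 2⁵·3` and is divisible by `3`, so `[ℚ(E[4]) : ℚ(e₁)]` is a power
of `2` (displayed as the hypothesis `hidx`, not derived here). [cite: Lim2017FineSelmer, §3 Thm. 3.5 and Lemma 3.2]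
[cite: CoatesSujatha2005, statement (A) and Thm. 3.4] -/
theorem finite_fineSelmer_twoTorsion_of_classicalMu
    (hLim : Lim2017.thm35_at_two_fineSelmerDual_moduleFinite_of_classicalMuVanishes_of_le_divisionField_four)
    (L : IntermediateField ℚ (AlgebraicClosure ℚ)) (hL : L ≤ W.divisionField 4)
    (hidx : ∃ k : ℕ, Module.finrank ℚ (W.divisionField 4) = 2 ^ k * Module.finrank ℚ L)
    (hμ : ∀ κL : ZpExtension L 2, κL.IsCyclotomic → ClassicalMuVanishes κL)
    (κ : ZpExtension ℚ 2) (hκ : κ.IsCyclotomic) :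
    Set.Finite {s : W.fineSelmerInfty κ | 2 • s = 0} := by
  obtain ⟨γ, D, hD⟩ := hLim W L hL hidx hμ κ hκ
  exact finite_pTorsion_of_fineSelmerDualData_moduleFinite W κ D hD

/-- **Statement (A) at `(E, 2)` when `ℚ(E[4])` contains an ABELIAN subfield of `2`-power index** — e.g. a
CYCLIC cubic `2`-division field (mod-`2` image `C₃`), or `L = ℚ` when `E` has a rational point of order `2`
— modulo two printed facts: Lim 2017 Thm. 3.5 at `2` and Ferrero–Washington (`μ = 0` for the cyclotomic
`ℤ₂`-extension of an abelian number field). Not the route's cell (there the cubic field is an `S₃`-cubic,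
for which Iwasawa's `μ = 0` is open), recorded as the road's first unconditional output.
[cite: Lim2017FineSelmer, §3 Thm. 3.5 and Lemma 3.2] [cite: Lang1990, Ch. 10 §3 Thm. 3.4 (pp. 258–261)] -/
theorem finite_fineSelmer_twoTorsion_of_abelian_subfield
    (hLim : Lim2017.thm35_at_two_fineSelmerDual_moduleFinite_of_classicalMuVanishes_of_le_divisionField_four)
    (hFW : ferreroWashington1979_classicalMuVanishes)
    (L : IntermediateField ℚ (AlgebraicClosure ℚ)) [IsAbelianGalois ℚ L] (hL : L ≤ W.divisionField 4)
    (hidx : ∃ k : ℕ, Module.finrank ℚ (W.divisionField 4) = 2 ^ k * Module.finrank ℚ L)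
    (κ : ZpExtension ℚ 2) (hκ : κ.IsCyclotomic) :
    Set.Finite {s : W.fineSelmerInfty κ | 2 • s = 0} := by
  haveI : NeZero (4 : ℕ) := ⟨by norm_num⟩
  haveI : FiniteDimensional ℚ L := FiniteDimensional.of_injective
    (IntermediateField.inclusion hL).toLinearMap (IntermediateField.inclusion_injective hL)
  haveI : NumberField L := NumberField.of_module_finite ℚ L
  exact finite_fineSelmer_twoTorsion_of_classicalMu W hLim L hL hidx (fun κL hκL => hFW L 2 κL hκL) κ hκ

end ConjA


end Summit.BirchSwinnertonDyer.BirchSwinnertonDyer.Theorems.AlignedTransportAtTwoFineRoad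

end
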